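import Summits.CriticalPhenomena.PercolationContinuityZ3.Theorems.PercNearOneGluingNoHeavyLowerTailSahiCombTriWUncrossingNormalForm

/-!
# CORE — the sharpened open statement behind `TRI_W(2)`: `triW ≥ Kl_{P∩G ∅}(F univ) + six shells of the uncrossed chains`

Support file of the one-cut programme (crux `NoHeavyLowerTail`, stmt-CriticalPhenomena-4575; TRI lane of cell `prim-masterthm`; seat prim-lf-1 gen 38,
memo `FROM-prim-lf-1-gen38-AN3-KERNEL.md` §6–§7).  By the normal form `triW_eq_uncrossed_normalForm`,
`triW P F G = AN♯3slack(Φ,Γ) + Kl_{P∩M_G}(M_F) + Kl_{P∩M_F}(M_G) + Kl_{P∩G∅}(F univ) + SH6(Φ,Γ) + X_a + X_b` for the uncrossed chains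
`Φ = (F ∅, M_F, J_F, F univ)`, `Γ = (G ∅, M_G, J_G, G univ)`.  The census of this seat (kit j165861/j165862: 2.1·10⁶ random configurations on cubes of
dimension ≤ 6; EXHAUSTIVE dimension 2: 169,344 configurations, and EXHAUSTIVE dimension 3: 1.15·10⁹ configurations = all up-sets `P` × all pairs of monotone
diamond families of `2^3`, kit j166266–274 — six of eight shards, 8.6·10⁸ configurations, complete at submission, 0 violations) found that the third Kleitman gap and
the six shells are NEVER needed: `AN♯3slack + Kl_{P∩M_G}(M_F) + Kl_{P∩M_F}(M_G) + X_a + X_b ≥ 0` in every instance.  Equivalently: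

* **`FiveUpSet.CoreIneq`** (`@[conjecture]`, OURS — an obligation of this theory, never a fact):
  `#(P ∩ F univ ∩ G ∅) − #(P ∩ refl(F univ) ∩ G ∅) + Σ_{six shells} #(P ∩ (Φ_{i+1}∖Φ_i) ∩ (Γ_{j+1}∖Γ_j)) ≤ triW P F G`
  for every two-atom index cube, every up-set `P` and all monotone families of up-sets `F, G`.  HALL FORM (memo §7): demands = AN♯3 demands of `(Φ,Γ)` ∪
  `{M_G ∩ refl M_F, M_F ∩ refl M_G}` ∪ 2×`refl D_a` ∪ 2×`refl D_b`; supplies = `X₁…X₅` ∪ 2×`(M_F ∩ M_G)` ∪ 2×`D_a` ∪ 2×`D_b` ∪ `{(G{a}∖M_G) ∩ refl(F{a}∖M_F)}` ∪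
  `{(F{a}∖M_F) ∩ refl(G{a}∖M_G)}` ∪ (b-versions), `D_a = (F{a}∖F{b}) ∩ (G{a}∖G{b})`.
* **`FiveUpSet.triW_nonneg_of_coreIneq`** — `CoreIneq → 0 ≤ triW P F G` (a = 2): the left side of `CoreIneq` is a Kleitman gap plus cardinalities, hence `≥ 0`.
So `CoreIneq ⟹ ChainTwoIneq-content (TriWIneq at a = 2)`; it is strictly sharper and its Hall system gives the weight-2 cells FOUR supply levels instead of two
(the reading-calculus obstruction of memo §3 does not apply verbatim).
HONEST LABEL: a typed conjecture (census-backed, NOT proved) and its one-line reduction. [this work]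
-/

namespace Summit.CriticalPhenomena.PercolationContinuityZ3.Theorems

namespace FiveUpSet

open Finset LatticeFiveUpSet

/-- **CORE** (CONJECTURE of ours; census: 2.1·10⁶ random configurations on cubes of dimension ≤ 6, all 169,344 configurations of dimension 2 and ≥ 8.6·10⁸ of the
1.15·10⁹ configurations of dimension 3 (exhaustive run, kit j166266–274), 0 violations, ≈ 5–20 % tight): for a two-atom index cube `univ = {a,b}`, an up-set `P` and monotone families of up-sets `F, G`, with `M_F = F{a} ∩ F{b}`, `J_F = F{a} ∪ F{b}`
(likewise for `G`):  `Kl_{P∩G ∅}(F univ) + Σ six shells ≤ triW P F G`. [this work] -/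
@[conjecture] def CoreIneq : Prop :=
  ∀ (β γ : Type) [DecidableEq β] [Fintype β] [DecidableEq γ] [Fintype γ] (a b : β)
    (P : Finset (Finset γ)) (F G : Finset β → Finset (Finset γ)),
    a ≠ b → (univ : Finset β) = {a, b} →
    IsUpperSet (P : Set (Finset γ)) → (∀ x, IsUpperSet (F x : Set (Finset γ))) → (∀ x, IsUpperSet (G x : Set (Finset γ))) →
    Monotone F → Monotone G →
    (((P ∩ F univ ∩ G ∅).card : ℤ) - (P ∩ refl (F univ) ∩ G ∅).card)
      + ((P ∩ ((F {a} ∩ F {b}) \ F ∅) ∩ ((G {a} ∩ G {b}) \ G ∅)).card + (P ∩ ((F {a} ∩ F {b}) \ F ∅) ∩ ((G {a} ∪ G {b}) \ (G {a} ∩ G {b}))).card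
          + (P ∩ ((F {a} ∪ F {b}) \ (F {a} ∩ F {b})) ∩ ((G {a} ∩ G {b}) \ G ∅)).card
          + (P ∩ (F univ \ (F {a} ∪ F {b})) ∩ ((G {a} ∩ G {b}) \ G ∅)).card + (P ∩ (F univ \ (F {a} ∪ F {b})) ∩ ((G {a} ∪ G {b}) \ (G {a} ∩ G {b}))).card
          + (P ∩ (F univ \ (F {a} ∪ F {b})) ∩ (G univ \ (G {a} ∪ G {b}))).card : ℕ)
      ≤ triW P F G

/-- **`CoreIneq ⟹ TRI_W(2) ≥ 0`**: the left side of `CoreIneq` is a Kleitman gap inside the up-set `P ∩ G ∅` (`card_inter_refl_le`) plus six cardinalities. [this work] -/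
theorem triW_nonneg_of_coreIneq (hC : CoreIneq) {γ : Type} [DecidableEq γ] [Fintype γ] {β : Type} [DecidableEq β] [Fintype β]
    {a b : β} (hab : a ≠ b) (hu : (univ : Finset β) = {a, b}) (P : Finset (Finset γ)) (F G : Finset β → Finset (Finset γ))
    (hP : IsUpperSet (P : Set (Finset γ))) (hF : ∀ x, IsUpperSet (F x : Set (Finset γ))) (hG : ∀ x, IsUpperSet (G x : Set (Finset γ)))
    (hFm : Monotone F) (hGm : Monotone G) :
    0 ≤ triW P F G := by
  have h := hC β γ a b P F G hab hu hP hF hG hFm hGm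
  have hPG : IsUpperSet ((P ∩ G ∅ : Finset (Finset γ)) : Set (Finset γ)) := by
    rw [coe_inter]; exact hP.inter (hG ∅)
  have hk := card_inter_refl_le hPG (hF univ)
  have e1 : P ∩ G ∅ ∩ F univ = P ∩ F univ ∩ G ∅ := by
    ext s; simp only [mem_inter]; tauto
  have e2 : P ∩ G ∅ ∩ refl (F univ) = P ∩ refl (F univ) ∩ G ∅ := by
    ext s; simp only [mem_inter]; tauto
  rw [e1, e2] at hk
  have hk' : ((P ∩ refl (F univ) ∩ G ∅).card : ℤ) ≤ (P ∩ F univ ∩ G ∅).card := by exact_mod_cast hk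
  linarith [Int.natCast_nonneg ((P ∩ ((F {a} ∩ F {b}) \ F ∅) ∩ ((G {a} ∩ G {b}) \ G ∅)).card + (P ∩ ((F {a} ∩ F {b}) \ F ∅) ∩ ((G {a} ∪ G {b}) \ (G {a} ∩ G {b}))).card
          + (P ∩ ((F {a} ∪ F {b}) \ (F {a} ∩ F {b})) ∩ ((G {a} ∩ G {b}) \ G ∅)).card
          + (P ∩ (F univ \ (F {a} ∪ F {b})) ∩ ((G {a} ∩ G {b}) \ G ∅)).card + (P ∩ (F univ \ (F {a} ∪ F {b})) ∩ ((G {a} ∪ G {b}) \ (G {a} ∩ G {b}))).card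
          + (P ∩ (F univ \ (F {a} ∪ F {b})) ∩ (G univ \ (G {a} ∪ G {b}))).card)]

/-- **Dominated reflected crossings ⟹ `TRI_W(2) ≥ 0`** (generalises `triW_nonneg_of_refl_crossings_disjoint`): if every point of `P` whose complement is a
double crossing is itself a double crossing of the same kind (`P ∩ refl D_a ⊆ D_a` and `P ∩ refl D_b ⊆ D_b`), then `0 ≤ triW P F G` — the crossing terms are
then `≥ 0` and `triW_ge_cross` applies. [this work] -/
theorem triW_nonneg_of_refl_crossings_subset {γ : Type} [DecidableEq γ] [Fintype γ] {β : Type} [DecidableEq β] [Fintype β]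
    {a b : β} (hab : a ≠ b) (hu : (univ : Finset β) = {a, b}) (P : Finset (Finset γ)) (F G : Finset β → Finset (Finset γ))
    (hP : IsUpperSet (P : Set (Finset γ))) (hF : ∀ x, IsUpperSet (F x : Set (Finset γ))) (hG : ∀ x, IsUpperSet (G x : Set (Finset γ)))
    (hFm : Monotone F) (hGm : Monotone G)
    (hDa : P ∩ refl ((F {a} \ F {b}) ∩ (G {a} \ G {b})) ⊆ (F {a} \ F {b}) ∩ (G {a} \ G {b}))
    (hDb : P ∩ refl ((F {b} \ F {a}) ∩ (G {b} \ G {a})) ⊆ (F {b} \ F {a}) ∩ (G {b} \ G {a})) :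
    0 ≤ triW P F G := by
  have h := triW_ge_cross hab hu P F G hP hF hG hFm hGm
  have ca : (P ∩ refl (F {a} \ F {b}) ∩ refl (G {a} \ G {b})).card ≤ (P ∩ (F {a} \ F {b}) ∩ (G {a} \ G {b})).card := by
    apply card_le_card
    intro s hs
    have hs' : s ∈ P ∩ refl ((F {a} \ F {b}) ∩ (G {a} \ G {b})) := by
      rw [refl_inter, ← inter_assoc]; exact hs
    exact mem_inter.2 ⟨mem_inter.2 ⟨(mem_inter.1 (mem_inter.1 hs).1).1, (mem_inter.1 (hDa hs')).1⟩, (mem_inter.1 (hDa hs')).2⟩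
  have cb : (P ∩ refl (F {b} \ F {a}) ∩ refl (G {b} \ G {a})).card ≤ (P ∩ (F {b} \ F {a}) ∩ (G {b} \ G {a})).card := by
    apply card_le_card
    intro s hs
    have hs' : s ∈ P ∩ refl ((F {b} \ F {a}) ∩ (G {b} \ G {a})) := by
      rw [refl_inter, ← inter_assoc]; exact hs
    exact mem_inter.2 ⟨mem_inter.2 ⟨(mem_inter.1 (mem_inter.1 hs).1).1, (mem_inter.1 (hDb hs')).1⟩, (mem_inter.1 (hDb hs')).2⟩
  have ca' : ((P ∩ refl (F {a} \ F {b}) ∩ refl (G {a} \ G {b})).card : ℤ) ≤ (P ∩ (F {a} \ F {b}) ∩ (G {a} \ G {b})).card := by exact_mod_cast ca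
  have cb' : ((P ∩ refl (F {b} \ F {a}) ∩ refl (G {b} \ G {a})).card : ℤ) ≤ (P ∩ (F {b} \ F {a}) ∩ (G {b} \ G {a})).card := by exact_mod_cast cb
  linarith [Int.natCast_nonneg (P ∩ refl (F {a} \ F {b}) ∩ (G {a} \ G {b})).card, Int.natCast_nonneg (P ∩ (F {a} \ F {b}) ∩ refl (G {a} \ G {b})).card,
    Int.natCast_nonneg (P ∩ refl (F {b} \ F {a}) ∩ (G {b} \ G {a})).card, Int.natCast_nonneg (P ∩ (F {b} \ F {a}) ∩ refl (G {b} \ G {a})).card]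

end FiveUpSet

end Summit.CriticalPhenomena.PercolationContinuityZ3.Theorems
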